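import Literature.MathematicalPhysics.QuantumLattice.XYStabilityTransferThreshold
import Literature.MathematicalPhysics.QuantumLattice.XYOrderGDProofs
import HarnessLib

/-!
# The KLS stability transfer at `W = 0`: the hypothesis `MeanGDn` holds with `κ = 0` by Gaussian domination, and the conditional theorem returns Kennedy–Lieb–Shastry's xy long-range order unconditionally

Topic `MathematicalPhysics/QuantumLattice`; theorem-only companion (plus one plumbing `def`, the
zero rule) of `XYStabilityTransfer.lean` and `XYStabilityTransferThreshold.lean`.

`XYStabilityTransfer.lean` lands the Kennedy–Lieb–Shastry transfer for the perturbed spin-½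
quantum XY model `H'_L = H_L + W_L` on the even tori `(ℤ/Lℤ)²` as a CONDITIONAL theorem:
`tracialLRO_of_uniformMeanGDn : 0 ≤ κ → κ < klsKappa₀ → UniformMeanGDn κ → …TracialLRO…`, with the
hypothesis predicates `AGD 𝒲 κ` (mode-wise approximate Gaussian domination) ⊆ `MeanGDn 𝒲 κ` typed as
DEFINITIONS and the unconditional transfer `klsTransferJn : KLSTransferJnAt klsKappa₀`. Its docstrings
state — but do not prove — that "at `W = 0` [the hypothesis] holds with `κ = 0` by Gaussian
domination". This file proves it and closes the loop:

* `zeroRule ε hε R : AdmissibleWsym ε R` — the rule `w_L = 0` (the unperturbed XY model is a member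
  of every admissible class; `zeroRule_H : (zeroRule ε hε R).H L = xyTorus 2 L 1`);
* `agd_zeroRule : AGD (zeroRule ε hε R).toAdmissibleW₀ 0` — this IS the tree's ground-state Gaussian
  domination `kls_xy_gaussianDomination_ground_holds` (`XYOrderGDProofs.lean`; Kennedy–Lieb–Shastry
  1988, eq. (18)) at `d = 2`, `S = ½`, read through the definitions; `meanGDn_zeroRule` likewise;
* `xy_tracialLRO_of_transfer` — instantiating `klsTransferJn` at `κ = 0` (admissible because
  `0 < klsKappa₀`, `klsKappa₀_pos` of `XYStabilityTransferThreshold.lean`) at the zero rule gives,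
  with NO hypothesis, tracial xy long-range order of the spin-½ XY model on `ℤ²`:
  `∃ c > 0, ∃ L₀, ∀ even L ≥ L₀, c·L⁴ ≤ Re ω_L(Σ_{x,y} (S¹_xS¹_y + S²_xS²_y))`, `ω_L` the tracial
  ground state of `xyTorus 2 L 1` — Kennedy–Lieb–Shastry's theorem (PRL 61 (1988) 2582, Theorem;
  in the tree in another vocabulary as `kennedy_lieb_shastry_xy_ground`), here as the `W = 0`
  CONSISTENCY CHECK of the landed transfer: the typed hypothesis is satisfiable and correctly
  oriented, and the conditional theorem is sharp at its anchor.

No statement of the tree is changed; no named fact is introduced (the one `def` is a non-`Prop`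
structure instance).

## References

* T. Kennedy, E. H. Lieb, B. S. Shastry, *The XY model has long-range order for all spins and all
  dimensions greater than one*, Phys. Rev. Lett. 61 (1988) 2582–2584: eq. (1) (the model), after
  eq. (4) (Gaussian domination), eq. (7) and the Theorem (xy-LRO for `S = ½`, `d = 2`). [KLS1988PRL]
* T. Kennedy, E. H. Lieb, B. S. Shastry, *Existence of Néel order in some spin-½ Heisenberg
  antiferromagnets*, J. Stat. Phys. 53 (1988) 1019–1030: eqs. (14), (17)–(19) (Gaussian domination in
  the ground state and the weighted sum). [KLS1988JSP]

## Mathlib and tree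

Mathlib: `Matrix.isHermitian_zero`, `Commute.zero_left`, `map_zero`, `norm_zero`,
`Finset.sum_le_sum`, `mul_le_mul_of_nonneg_left`. Tree: `AdmissibleW₀/AdmissibleW/AdmissibleWsym`,
`AdmissibleW₀.W/H/gdGain/lroSum`, `AGD`, `MeanGDn`, `TracialLRO`, `KLSTransferJnAt`, `klsTransferJn`,
`gdGain_le_of_AGD`, `klsWeight`, `cosWave`, `sinWave` (`XYStabilityTransfer.lean`); `klsKappa₀_pos`
(`XYStabilityTransferThreshold.lean`); `kls_xy_gaussianDomination_ground_holds`
(`XYOrderGDProofs.lean`), `xyFieldHamiltonian` (`XYOrderInfrared.lean`); `IsSupportedOn.zero`,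
`reindexOp` (`SpinSystem.lean`); `klsIntegrand_nonneg` (`XYOrderProofs.lean`),
`dispersion_nonneg` (`Probability/LatticeModels/TorusFourier.lean`).
-/

noncomputable section

open Matrix Finset
open scoped ComplexOrder Matrix.Norms.L2Operator
open Literature.MathematicalPhysics.QuantumLattice Literature.Probability.LatticeModels

namespace Literature.MathematicalPhysics.QuantumLattice.XYStabilityTransfer

section ZeroRule

variable {ε : ℝ} {hε : 0 ≤ ε} {R : ℕ}

/-- **The zero rule** `w_L = 0` of nominal range `R` and strength `ε ≥ 0`: the unperturbed spin-½ XY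
model `H'_L = H_L` as a member of the class `AdmissibleWsym ε R` (Hermitian, supported anywhere,
norm `0 ≤ ε`, `U(1)`-invariant, real, swap-symmetric — all trivially). [cite: KLS1988PRL, eq. (1)] -/
def zeroRule (ε : ℝ) (hε : 0 ≤ ε) (R : ℕ) : AdmissibleWsym ε R where
  w := fun _ _ => 0
  herm := fun _ _ => Matrix.isHermitian_zero
  supp := fun _ _ => IsSupportedOn.zero _
  norm_le := fun _ _ => by rw [norm_zero]; exact hε
  u1 := fun _ _ => Commute.zero_left _
  real := fun _ _ => Matrix.map_zero _ (map_zero _)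
  swap := fun _ _ => map_zero _

/-- The zero rule's generating term is `0`. [folklore] -/
@[simp] private theorem zeroRule_w (L : ℕ) [NeZero L] : (zeroRule ε hε R).w L = 0 := rfl

/-- `W_L = Σ_v τ_v 0 = 0` for the zero rule. [folklore] -/
private theorem zeroRule_W (L : ℕ) [NeZero L] : (zeroRule ε hε R).toAdmissibleW₀.W L = 0 := by
  unfold AdmissibleW₀.W
  exact Finset.sum_eq_zero fun v _ => by
    rw [show (zeroRule ε hε R).toAdmissibleW₀.w L = 0 from rfl, map_zero]

/-- `H'_L = H_L = xyTorus 2 L 1` for the zero rule: the unperturbed spin-½ XY model.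
[cite: KLS1988PRL, eq. (1)] -/
theorem zeroRule_H (L : ℕ) [NeZero L] : (zeroRule ε hε R).toAdmissibleW₀.H L = xyTorus 2 L 1 := by
  unfold AdmissibleW₀.H
  rw [zeroRule_W, add_zero]

/-- **Gaussian domination at `W = 0` is `AGD` with `κ = 0`**: for the zero rule the mode-wise
hypothesis `AGD 𝒲 0` of the landed transfer is EXACTLY the tree's ground-state Gaussian domination
`E₀(H_L) ≤ E₀(H_L − V_h + E(h)/2)` (`kls_xy_gaussianDomination_ground_holds`, `d = 2`, `S = ½`).
[cite: KLS1988JSP, eq. (18)] [cite: KLS1988PRL, after eq. (4)] -/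
theorem agd_zeroRule : AGD (zeroRule ε hε R).toAdmissibleW₀ 0 := by
  intro L _ hL h4 h
  rw [zeroRule_H]
  have hGD := kls_xy_gaussianDomination_ground_holds 2 1 L hL h4 h
  have h1 : ((1 + (0 : ℝ)) * xyFieldEnergy L h / 2 : ℝ) = xyFieldEnergy L h / 2 := by ring
  rw [h1]
  exact hGD

/-- The KLS weights `F₂(p_q)/E_q` are nonnegative (reproved here: the tree's lemma is private).
[folklore] -/
private theorem klsWeight_nonneg' (L : ℕ) [NeZero L] (q : TorusSite 2 L) : 0 ≤ klsWeight L q :=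
  div_nonneg (klsIntegrand_nonneg 2 _) (dispersion_nonneg _)

/-- **`MeanGDn` holds at `W = 0` with `κ = 0`** (termwise from `agd_zeroRule`, nonnegative weights) —
the docstring sentence "at `W = 0` it holds with `κ = 0` by Gaussian domination" of
`XYStabilityTransfer.lean` as a theorem. [cite: KLS1988JSP, eqs. (14), (18)–(19)] -/
theorem meanGDn_zeroRule : MeanGDn (zeroRule ε hε R).toAdmissibleW₀ 0 := by
  intro L _ hL h4
  refine ⟨1, one_pos, fun t _ => ?_⟩
  rw [Finset.mul_sum]
  refine Finset.sum_le_sum fun q _ => ?_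
  have hF : 0 ≤ klsWeight L q := klsWeight_nonneg' L q
  have hc := gdGain_le_of_AGD (agd_zeroRule (ε := ε) (hε := hε) (R := R)) L hL h4 (t • cosWave L q)
  have hs := gdGain_le_of_AGD (agd_zeroRule (ε := ε) (hε := hε) (R := R)) L hL h4 (t • sinWave L q)
  calc klsWeight L q * ((zeroRule ε hε R).toAdmissibleW₀.gdGain L (t • cosWave L q) +
        (zeroRule ε hε R).toAdmissibleW₀.gdGain L (t • sinWave L q))
      ≤ klsWeight L q * ((1 + 0) * xyFieldEnergy L (t • cosWave L q) / 2 +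
          (1 + 0) * xyFieldEnergy L (t • sinWave L q) / 2) :=
        mul_le_mul_of_nonneg_left (add_le_add hc hs) hF
    _ = (1 + 0) / 2 * (klsWeight L q *
        (xyFieldEnergy L (t • cosWave L q) + xyFieldEnergy L (t • sinWave L q))) := by ring

/-- **The transfer at its anchor**: for every nominal range `R` the landed unconditional transfer
`klsTransferJn`, instantiated at `κ = 0` (admissible since `0 < klsKappa₀`, `klsKappa₀_pos`) and at
the zero rule of the strength `ε₀` it produces, yields tracial xy long-range order of the zero
rule. [cite: KLS1988PRL, eq. (7) and Theorem] -/
theorem tracialLRO_zeroRule (R : ℕ) :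
    ∃ ε₀ : ℝ, ∃ hε₀ : 0 < ε₀, ∃ c > 0, ∃ L₀ : ℕ,
      TracialLRO (zeroRule ε₀ hε₀.le R).toAdmissibleW₀ c L₀ := by
  obtain ⟨ε₀, hε₀, c, hc, L₀, h⟩ := klsTransferJn 0 le_rfl klsKappa₀_pos R
  exact ⟨ε₀, hε₀, c, hc, L₀, h (zeroRule ε₀ hε₀.le R) meanGDn_zeroRule⟩

/-- **Kennedy–Lieb–Shastry's xy long-range order (spin ½, `d = 2`, tracial ground state) re-derived
through the landed stability transfer with NO hypothesis**: there are `c > 0` and `L₀` such that for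
every even `L ≥ L₀`, `c·L⁴ ≤ Re ω_L(Σ_{x,y} (S¹_xS¹_y + S²_xS²_y))`, `ω_L` the tracial ground-state
functional of `xyTorus 2 L 1`. This is the `W = 0` consistency check of `XYStabilityTransfer.lean`:
hypothesis satisfiable (`meanGDn_zeroRule`), window non-empty (`klsKappa₀_pos`), conclusion = the
printed theorem. [cite: KLS1988PRL, Theorem and eq. (7)] -/
theorem xy_tracialLRO_of_transfer :
    ∃ c > 0, ∃ L₀ : ℕ, ∀ (L : ℕ) [NeZero L], Even L → L₀ ≤ L →
      c * (L : ℝ) ^ 4 ≤ ((xyTorus 2 L 1).groundStateFunctional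
        (∑ x : TorusSite 2 L, ∑ y : TorusSite 2 L,
          (siteSpin 1 x 0 * siteSpin 1 y 0 + siteSpin 1 x 1 * siteSpin 1 y 1))).re := by
  obtain ⟨ε₀, hε₀, c, hc, L₀, h⟩ := tracialLRO_zeroRule 0
  refine ⟨c, hc, L₀, fun L _ hL hL₀ => ?_⟩
  have hT := h L hL hL₀
  unfold AdmissibleW₀.lroSum at hT
  rw [zeroRule_H] at hT
  exact hT

end ZeroRule

end Literature.MathematicalPhysics.QuantumLattice.XYStabilityTransfer

end
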